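import Mathlib

/-!
# Rank-four faces of a Galois CM field in the finite model `(G, c)` — the generic census engine over a Cayley table

Part of the self-contained statement set `Summits/Ventures/HodgeRepro/Statements.lean` (statement (a), the rank-four face
census).  This file fixes NO group: it is the common engine of the census rows (`FaceCensusRows8.lean`, `FaceCensusRows12.lean`),
written so that every census statement is a closed `Bool`/`ℕ` computation on numerals.  Definitions only.  Nothing is proved or asserted in this file; nothing here says anything about the status of the Hodge conjecture for CM abelian varieties, which is NOT proved.
-/

set_option autoImplicit false

namespace Summit.Ventures.HodgeRepro

/-! ## A.  The rank-four face census for Galois CM fields of degree 6, 8 and 12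

### A.1  The finite model `(G, c)` — a generic engine over a Cayley table

`F` a Galois CM field, `G = Gal(F/ℚ) = {g_0, …, g_{n-1}}`, one embedding `σ₀ : F → ℂ` fixed, so that `Hom(F, ℂ) = {σ₀ ∘ g} ≅ G`;
complex conjugation `c ∈ Z(G)`.  The group is a CAYLEY TABLE on `Fin n` (`CMGaloisType`), a CM type / label is a BITMASK `T < 2^n`
(bit `i` ↔ the embedding `g_i`), a set of types is a SORTED `List ℕ`, so that every census statement is a closed `Bool`/`ℕ`
computation on numerals.  A CM type is `T ⊆ G` with `T ⊔ cT = G` (`isCMType`); the infinite place of `g` is `{g, c g}` (`placeMask`);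
the flip of `T` at a place is the symmetric difference (`flipAt` = `xor`); a FACE is `(Φ; π, π′)` with `Φ` a CM type and `π ≠ π′`
places; its four CORNERS are `Φ, (Φ̄)^{(π)}, (Φ̄)^{(π′)}, Φ^{(ππ′)}` (`corners`) and its TYPE SQUARE is `{Φ, Φ^{(π)}, Φ^{(π′)}, Φ^{(ππ′)}}`
(`square`).  The Galois twist of the `F`-structure by `g ∈ G` is RIGHT translation `T ↦ T·g` (`twist`): `A_{T·g}` is the complex
torus `A_T` with `F` acting through `g`, so faces whose type squares lie in one `G`-orbit are Galois conjugate.  `SumTwo`: every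
embedding lies in exactly two corners (the corner product carries a Weil line of Hodge type `(2,2)`); `noConjugateCorners`: no two
corners are complex-conjugate types (the face class has no divisor-pair factor).  Simple factors: the right stabiliser `Stab(T)` cuts
out `K = F^{Stab T}` and `A_T ~ B^{|Stab T|}` with `B` simple of dimension `n / 2|Stab T|` (Milne, *Lefschetz motives and the Tate
conjecture*, Compositio Math. 117 (1999), Prop. 2.1); Hodge classes on products of the `A_T` are read off exponent vectors by
Pohlmann's criterion (Ann. of Math. 88 (1968), Thm. 1). -/

namespace FaceCensus

/-- A Galois CM closure type `(G, c)` of order `n` as a CAYLEY TABLE on `Fin n`: `mul i j` is the index of `g_i · g_j`, `one` the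
index of the identity, `conj` the index of complex conjugation.  (Group axioms and centrality of `conj` are the `Bool` check
`isCMGaloisType`.) -/
structure CMGaloisType (n : ℕ) where
  /-- Cayley table -/
  mul : Fin n → Fin n → Fin n
  /-- the identity -/
  one : Fin n
  /-- complex conjugation, a central involution -/
  conj : Fin n

/-! #### `G`-independent helpers: bitmasks over `Fin n` -/

/-- `g_i ∈ T` (bit `i` of the mask `T`). -/
def mem {n : ℕ} (i : Fin n) (T : ℕ) : Bool := T.testBit i.val

/-- The singleton mask `{g_i}`. -/
def bit {n : ℕ} (i : Fin n) : ℕ := 2 ^ i.val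

/-- Image of a type under a map of `G` (as a mask). -/
def imageMask {n : ℕ} (f : Fin n → Fin n) (T : ℕ) : ℕ :=
  (List.finRange n).foldl (fun acc i => if mem i T then acc ||| bit (f i) else acc) 0

/-- Flip of a type at a place (both masks): `T ∆ π`. -/
def flipAt (π T : ℕ) : ℕ := T ^^^ π

/-- Sorted insertion (structural recursion, so that it reduces under `decide`). -/
def insertNat (a : ℕ) : List ℕ → List ℕ
  | [] => [a]
  | b :: l => if a ≤ b then a :: b :: l else b :: insertNat a l

/-- Insertion sort on `ℕ` (structural). -/
def sortNat : List ℕ → List ℕ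
  | [] => []
  | a :: l => insertNat a (sortNat l)

/-- A set of types in normal form: sorted, duplicates removed. -/
def normalize (S : List ℕ) : List ℕ := (sortNat S).eraseDups

/-- The type square `{Φ, Φ^{(π)}, Φ^{(π′)}, Φ^{(ππ′)}}` of the face `f = (Φ, π, π′)`, in normal form. -/
def square (f : ℕ × ℕ × ℕ) : List ℕ :=
  normalize [f.1, flipAt f.2.1 f.1, flipAt f.2.2 f.1, flipAt f.2.2 (flipAt f.2.1 f.1)]

/-- The members of a mask, as indices in `Fin n` (for reading the data). -/
def decode (n : ℕ) (T : ℕ) : List (Fin n) := (List.finRange n).filter fun i => mem i T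

namespace CMGaloisType

variable {n : ℕ} (Γ : CMGaloisType n)

/-- `Bool` check of the axioms: associativity, two-sided identity, existence of inverses, `conj` a central involution `≠ 1`. -/
def isCMGaloisType : Bool :=
  ((List.finRange n).all fun i => (List.finRange n).all fun j => (List.finRange n).all fun k => Γ.mul (Γ.mul i j) k == Γ.mul i (Γ.mul j k)) &&
  ((List.finRange n).all fun i => Γ.mul Γ.one i == i && Γ.mul i Γ.one == i) &&
  ((List.finRange n).all fun i => (List.finRange n).any fun j => Γ.mul i j == Γ.one) &&
  ((List.finRange n).all fun i => Γ.mul Γ.conj i == Γ.mul i Γ.conj) && (Γ.mul Γ.conj Γ.conj == Γ.one) && !(Γ.conj == Γ.one)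

/-! #### Types as bitmasks -/

/-- `T` is a CM type: for every `g`, exactly one of `g`, `c g` lies in `T` (and no bit beyond `n`). -/
def isCMType (T : ℕ) : Bool := (T < 2 ^ n) && (List.finRange n).all fun i => mem i T != mem (Γ.mul Γ.conj i) T

/-- The `2^{n/2}` CM types, increasing. -/
def cmTypes : List ℕ := (List.range (2 ^ n)).filter Γ.isCMType

/-- The place `{g, c g}` of `g` as a mask. -/
def placeMask (i : Fin n) : ℕ := bit i ||| bit (Γ.mul Γ.conj i)

/-- The `n/2` places, increasing, without repetition. -/
def places : List ℕ := normalize ((List.finRange n).map Γ.placeMask)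

/-- Conjugate type `T̄ = cT`. -/
def bar (T : ℕ) : ℕ := imageMask (fun i => Γ.mul Γ.conj i) T

/-- Galois twist by `g_j`: right translation `T ↦ T·g_j`. -/
def twist (j : Fin n) (T : ℕ) : ℕ := imageMask (fun i => Γ.mul i j) T

/-! #### Faces, corners, squares, orbits -/

/-- The faces `(Φ; π, π′)`: a CM type and an ordered pair of distinct places. -/
def faces : List (ℕ × ℕ × ℕ) :=
  Γ.cmTypes.flatMap fun T => Γ.places.flatMap fun p => (Γ.places.filter fun q => q != p).map fun q => (T, p, q)

/-- The four corners `Φ, (Φ̄)^{(π)}, (Φ̄)^{(π′)}, Φ^{(ππ′)}` of a face. -/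
def corners (f : ℕ × ℕ × ℕ) : List ℕ :=
  [f.1, flipAt f.2.1 (Γ.bar f.1), flipAt f.2.2 (Γ.bar f.1), flipAt f.2.2 (flipAt f.2.1 f.1)]

/-- The type squares, in normal form, without repetition. -/
def squares : List (List ℕ) := (Γ.faces.map square).eraseDups

/-- Twist of a set of types, renormalised. -/
def twistSet (j : Fin n) (S : List ℕ) : List ℕ := normalize (S.map (Γ.twist j))

/-- `S′` is a Galois twist of `S`. -/
def isTwistOf (S S' : List ℕ) : Bool := (List.finRange n).any fun j => Γ.twistSet j S == S'

/-- Size of the `G`-orbit of a set of types. -/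
def orbitSize (S : List ℕ) : ℕ := (((List.finRange n).map fun j => Γ.twistSet j S).eraseDups).length

/-- `reps` (faces) represent the `G`-orbits of type squares: every square is a twist of the square of some representative, the
representatives are faces, and their squares are pairwise inequivalent. -/
def isSquareOrbitReps (reps : List (ℕ × ℕ × ℕ)) : Bool :=
  (Γ.squares.all fun S => reps.any fun r => Γ.isTwistOf (square r) S) && (reps.all fun r => Γ.faces.contains r) &&
  ((List.finRange reps.length).all fun a => (List.finRange reps.length).all fun b =>
    a == b || !(Γ.isTwistOf (square (reps.getD a.val (0,0,0))) (square (reps.getD b.val (0,0,0)))))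

/-- All twists of the squares of a list of faces, tagged by position (precomputation for `squareOrbitRepsFast`). -/
def repSquareTwists (rs : List (ℕ × ℕ × ℕ)) : List (List ℕ × ℕ) :=
  (List.zipIdx rs).flatMap fun ri => (List.finRange n).map fun j => (Γ.twistSet j (square ri.1), ri.2)

/-- `isSquareOrbitReps` with precomputed twist lists (the form used at order `12`): every square is a twist of some
representative's square, the representatives are faces, and no representative's square is a twist of another's. -/
def squareOrbitRepsFast (rs : List (ℕ × ℕ × ℕ)) : Bool :=
  let tw := Γ.repSquareTwists rs
  (Γ.squares.all fun S => tw.any fun p => p.1 == S) && (rs.all fun r => Γ.faces.contains r) &&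
    ((List.zipIdx rs).all fun ri => tw.all fun p => !(p.1 == square ri.1) || p.2 == ri.2)

/-- `SumTwo`: every embedding lies in exactly two corners. -/
def sumTwo (f : ℕ × ℕ × ℕ) : Bool := (List.finRange n).all fun i => ((Γ.corners f).filter fun T => mem i T).length == 2

/-- The corners are four pairwise distinct CM types. -/
def cornersWF (f : ℕ × ℕ × ℕ) : Bool := (Γ.corners f).all Γ.isCMType && (Γ.corners f).eraseDups.length == 4

/-- No two corners are conjugate (`L̄ ≠ L′` for all corners `L, L′`): the face class has NO divisor-pair factor (it is
"exceptional" in Pohlmann's sense). -/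
def noConjugateCorners (f : ℕ × ℕ × ℕ) : Bool := (Γ.corners f).all fun L => !((Γ.corners f).contains (Γ.bar L))

end CMGaloisType

end FaceCensus

end Summit.Ventures.HodgeRepro
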